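import Literature.NumberTheory.EllipticCurves.NoConductorOne
import HarnessLib

/-!
# Good supersingular reduction at `2` forces `Δ_min ≡ 5 (mod 8)`

Topic `Literature/NumberTheory/EllipticCurves`; THEOREMS ONLY (no definition, no named fact; net Literature debt `0`).
Literature-prover `-ty` g22 of cell `bsd-f1-sign2`, serving REF1-AUDIT §314 rider R314c («row (Θ-ss-5) at the generality
"`W/ℚ`, good supersingular reduction at `2`, `v₂(Δ_W) = 0` ⟹ `Δ_W ≡ 5 (8)`" belongs in `Literature/NumberTheory/EllipticCurves/`
(Serre 1972 §1.11 + five lines)»): the cell row (Θ-ss-5) `SupersingularAtTwoDiscriminantModEight` of -an g29's §32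
(`Summits/BirchSwinnertonDyer/Rank1Residual/F1Sign2/DefiniteMod2WaldspurgerGaussianEdgeAtTwo.lean`) is its corollary.

**Statement (as printed, Serre 1972 §1.11, `e = 1`).**  Let `E/ℚ₂` have good SUPERSINGULAR reduction.  Then inertia acts on
`E[2]` through the fundamental character of level `2` onto the cyclic subgroup `C₃ ⊂ GL₂(𝔽₂) ≅ S₃`, Frobenius normalises it
non-trivially, so the sign (discriminant) character `χ_Δ` of `ℚ₂(E[2])/ℚ₂` is the UNRAMIFIED quadratic character:
`Δ ∈ 5·ℚ₂^{×2}`; for a model with `v₂(Δ) = 0` this reads `Δ ≡ 5 (mod 8)`.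

**Proof given here (elementary, model-theoretic — the same fact read on a minimal Weierstrass equation; Silverman AEC V.4,
Ex. 5.7: in characteristic `2`, supersingular ⟺ `j = ā₁¹²/Δ̄ = 0` ⟺ `ā₁ = 0`).**
(1) Over `𝔽₂` an elliptic curve with `a₁ = 1` has a rational point of order `2` (`x = a₃`), so an EVEN number of points;
hence good reduction at `2` and `a₂(W) = 3 − #W̃(𝔽₂)` even force `a₁` even on the minimal equation
(`two_dvd_a₁_integralModelInt_of_two_dvd_frobeniusTrace_two`).
(2) RING IDENTITY: if `a₁ = 2s` then `Δ + 27·b₆² = 8·(−2u²b₈ − 8v³ + 9uvb₆)` with `b₂ = 4u`, `b₄ = 2v` (`u = s² + a₂`,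
`v = a₄ + s·a₃`) — `Δ_add_mul_b₆_sq_eq_eight_mul_of_a₁_eq_two_mul`; so `Δ ≡ −27·b₆² (mod 8)`; `Δ` odd forces `b₆` odd, `b₆² ≡ 1 (mod 8)`,
and `Δ ≡ −27 ≡ 5 (mod 8)` (`Δ_emod_eight_eq_five_of_even_a₁_of_odd_Δ`).
(3) `minimalDiscriminantInt_emod_eight_eq_five_of_two_dvd_frobeniusTrace_two`: for `W/ℚ` in global minimal form with good
reduction at `2` (so `2 ∤ Δ_min`, tree `not_dvd_minimalDiscriminantInt_of_hasGoodReductionAtPrime'`) and `a₂(W)` even: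
`Δ_min ≡ 5 (mod 8)`.

## References

* [Serre1972] J.-P. Serre, *Propriétés galoisiennes des points d'ordre fini des courbes elliptiques*, Invent. Math. 15
  (1972), §1.11 (image of inertia at a prime of good supersingular reduction, `e = 1`).
* [SilvermanAEC2009] J. H. Silverman, *The Arithmetic of Elliptic Curves*, 2nd ed.: III.1 (b-invariants, `Δ`), III.2.3,
  V.4 and Exercise 5.7 (supersingular in characteristic 2), VII.5 Prop. 5.1(a).
-/

noncomputable section

open scoped Classical
open WeierstrassCurve

namespace Literature.NumberTheory.EllipticCurves

/-! ### (2) The ring identity and the congruence mod 8 -/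

/-- **`a₁ = 2s ⟹ Δ + 27 b₆² = 8·(−2u²b₈ − 8v³ + 9uvb₆)`**, `u = s² + a₂`, `v = a₄ + s a₃` (so `b₂ = 4u`, `b₄ = 2v`): the
discriminant `Δ = −b₂²b₈ − 8b₄³ − 27b₆² + 9b₂b₄b₆` of a Weierstrass equation with even `a₁`, over any commutative ring.
[cite: SilvermanAEC2009, III.1 (definition of b₂, b₄, b₆, b₈, Δ)] -/
theorem Δ_add_mul_b₆_sq_eq_eight_mul_of_a₁_eq_two_mul {R : Type*} [CommRing R] (M : WeierstrassCurve R) (s : R)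
    (h : M.a₁ = 2 * s) :
    M.Δ + 27 * M.b₆ ^ 2 =
      8 * (-2 * (s ^ 2 + M.a₂) ^ 2 * M.b₈ - 8 * (M.a₄ + s * M.a₃) ^ 3 + 9 * (s ^ 2 + M.a₂) * (M.a₄ + s * M.a₃) * M.b₆) := by
  simp only [WeierstrassCurve.Δ, WeierstrassCurve.b₂, WeierstrassCurve.b₄, h]
  ring

/-- **`a₁` even and `Δ` odd ⟹ `Δ ≡ 5 (mod 8)`** for an integral Weierstrass equation: `Δ ≡ −27 b₆² (mod 8)` by the ring identity,
`Δ` odd forces `b₆` odd, and an odd square is `≡ 1 (mod 8)`.  (Lean's `Int.emod` is non-negative: `Δ % 8 = 5` also for `Δ < 0`.)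
[cite: Serre1972, §1.11 (supersingular at 2, e = 1: the discriminant character is unramified)] -/
theorem Δ_emod_eight_eq_five_of_even_a₁_of_odd_Δ (M : WeierstrassCurve ℤ) (h1 : Even M.a₁) (hΔ : Odd M.Δ) :
    M.Δ % 8 = 5 := by
  obtain ⟨s, hs⟩ := h1
  have hid := Δ_add_mul_b₆_sq_eq_eight_mul_of_a₁_eq_two_mul M s (by rw [hs]; ring)
  set K := -2 * (s ^ 2 + M.a₂) ^ 2 * M.b₈ - 8 * (M.a₄ + s * M.a₃) ^ 3 + 9 * (s ^ 2 + M.a₂) * (M.a₄ + s * M.a₃) * M.b₆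
    with hK
  -- `b₆` is odd, for otherwise `Δ = 8K − 27 b₆²` would be even
  have hb6 : Odd M.b₆ := by
    by_contra heven
    rw [Int.not_odd_iff_even] at heven
    obtain ⟨t, ht⟩ := heven
    have : M.Δ = 8 * K - 27 * (t + t) ^ 2 := by rw [← ht]; linear_combination hid
    have hev : Even M.Δ := ⟨4 * K - 54 * t ^ 2, by rw [this]; ring⟩
    exact (Int.not_even_iff_odd.mpr hΔ) hev
  obtain ⟨t, ht⟩ := hb6
  -- `t (t + 1)` is even
  obtain ⟨r, hr⟩ := Int.even_mul_succ_self t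
  have hsq : M.b₆ ^ 2 = 8 * r + 1 := by
    rw [ht]
    have : (2 * t + 1) ^ 2 = 4 * (t * (t + 1)) + 1 := by ring
    rw [this, hr]; ring
  have hΔ' : M.Δ = 8 * (K - 27 * r) - 27 := by linear_combination hid - 27 * hsq
  omega

/-! ### (1) Characteristic `2`: `a₁ = 1` gives a rational point of order `2`, hence an even point count -/

/-- Over `𝔽₂` with `a₁ = 1`, the point `(a₃, a₃³ + a₂a₃² + a₄a₃ + a₆)` satisfies the Weierstrass equation (there `y² + xy + a₃y`
at `x = a₃` is `y² = y`). [folklore] -/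
private theorem charTwo_equation_aux :
    ∀ a₂ a₃ a₄ a₆ : ZMod 2,
      (a₃ ^ 3 + a₂ * a₃ ^ 2 + a₄ * a₃ + a₆) ^ 2 + 1 * a₃ * (a₃ ^ 3 + a₂ * a₃ ^ 2 + a₄ * a₃ + a₆) +
          a₃ * (a₃ ^ 3 + a₂ * a₃ ^ 2 + a₄ * a₃ + a₆) =
        a₃ ^ 3 + a₂ * a₃ ^ 2 + a₄ * a₃ + a₆ := by
  decide

/-- Over `𝔽₂` with `a₁ = 1`, the point with `x = a₃` is its own negative. [folklore] -/
private theorem charTwo_negY_aux : ∀ a₃ y : ZMod 2, -y - 1 * a₃ - a₃ = y := by decide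

/-- **Over `𝔽₂`, an elliptic curve with `a₁ = 1` (ordinary, `j ≠ 0`) has a rational point of order `2`, so `2` divides its number
of points**: `P = (a₃, a₃³ + a₂a₃² + a₄a₃ + a₆)` lies on the curve and `−P = (a₃, −y − a₁a₃ − a₃) = P` (Silverman III.2.3), `P ≠ O`.
[cite: SilvermanAEC2009, III.2.3 (negation formula) and V.4 (first paragraph)] -/
theorem two_dvd_natCard_point_of_a₁_eq_one (E : WeierstrassCurve (ZMod 2)) [E.IsElliptic] [Finite E.toAffine.Point]
    (h1 : E.a₁ = 1) : 2 ∣ Nat.card E.toAffine.Point := by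
  set y₀ : ZMod 2 := E.a₃ ^ 3 + E.a₂ * E.a₃ ^ 2 + E.a₄ * E.a₃ + E.a₆ with hy₀
  have heq : E.toAffine.Equation E.a₃ y₀ := by
    rw [WeierstrassCurve.Affine.equation_iff]
    change y₀ ^ 2 + E.a₁ * E.a₃ * y₀ + E.a₃ * y₀ = E.a₃ ^ 3 + E.a₂ * E.a₃ ^ 2 + E.a₄ * E.a₃ + E.a₆
    rw [h1, hy₀]
    exact charTwo_equation_aux E.a₂ E.a₃ E.a₄ E.a₆
  have hns : E.toAffine.Nonsingular E.a₃ y₀ := (Affine.equation_iff_nonsingular).mp heq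
  set P : E.toAffine.Point := Affine.Point.some E.a₃ y₀ hns with hP
  have hneg : -P = P := by
    rw [hP, Affine.Point.neg_some, Affine.Point.some.injEq]
    refine ⟨rfl, ?_⟩
    change -y₀ - E.a₁ * E.a₃ - E.a₃ = y₀
    rw [h1]
    exact charTwo_negY_aux E.a₃ y₀
  have hP0 : P ≠ 0 := by
    rw [hP]
    exact Affine.Point.some_ne_zero hns
  have hord : addOrderOf P = 2 := by
    rw [addOrderOf_eq_prime_iff]
    refine ⟨?_, hP0⟩
    rw [two_nsmul]
    nth_rw 1 [← hneg]
    exact neg_add_cancel P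
  have hdvd := addOrderOf_dvd_natCard P
  rwa [hord] at hdvd

variable (W : WeierstrassCurve ℚ) [W.IsGloballyMinimal]

/-- **Good reduction at `2` and `a₂(W)` even ⟹ `a₁` of the minimal equation is even** (`W mod 2` is supersingular iff `ā₁ = 0`;
contrapositive: `ā₁ = 1` ⟹ `#W̃(𝔽₂)` even ⟹ `a₂ = 3 − #W̃(𝔽₂)` odd).  Here `a₂(W) = W.frobeniusTrace 2` (`GlobalMinimalModel`).
[cite: SilvermanAEC2009, V.4 (first paragraph) and Exercise 5.7 (supersingular in characteristic 2 iff j = 0 iff a₁ = 0)] -/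
theorem two_dvd_a₁_integralModelInt_of_two_dvd_frobeniusTrace_two (hgood : W.HasGoodReductionAtPrime 2)
    (heven : (2 : ℤ) ∣ W.frobeniusTrace 2) : (2 : ℤ) ∣ (integralModelInt W).a₁ := by
  by_contra hodd
  have hodd' : Odd (integralModelInt W).a₁ := by
    rw [← Int.not_even_iff_odd, even_iff_two_dvd]; exact hodd
  set E : WeierstrassCurve (ZMod 2) := (integralModelInt W).map (Int.castRingHom (ZMod 2)) with hE
  have hΔ : E.Δ ≠ 0 := by
    rw [hE, map_Δ, eq_intCast, ne_eq, ZMod.intCast_zmod_eq_zero_iff_dvd]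
    exact_mod_cast not_dvd_minimalDiscriminantInt_of_hasGoodReductionAtPrime' W 2 hgood
  haveI : E.IsElliptic := ⟨isUnit_iff_ne_zero.mpr hΔ⟩
  have ha1 : E.a₁ = 1 := by
    rw [hE, map_a₁, eq_intCast]
    obtain ⟨k, hk⟩ := hodd'
    rw [hk]
    push_cast
    rw [show (2 : ZMod 2) = 0 from rfl, zero_mul, zero_add]
  have h2 : 2 ∣ W.reductionPointCount 2 := by
    rw [WeierstrassCurve.reductionPointCount]
    exact two_dvd_natCard_point_of_a₁_eq_one E ha1
  obtain ⟨k, hk⟩ := h2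
  have htr : W.frobeniusTrace 2 = 3 - 2 * (k : ℤ) := by
    rw [WeierstrassCurve.frobeniusTrace, hk]; push_cast; ring
  rw [htr] at heven
  omega

/-! ### (3) The statement for a globally minimal equation over `ℚ` -/

/-- **Good supersingular reduction at `2` ⟹ `Δ_min ≡ 5 (mod 8)`** (Serre 1972 §1.11 read on the minimal equation): for `W/ℚ` in
global minimal form with good reduction at `2` and `a₂(W) = W.frobeniusTrace 2` even, the minimal discriminant satisfies
`Δ_min % 8 = 5` (in particular `Δ_min ≡ 5 (mod 8)` and `Δ_min ∈ 5·ℤ₂^{×2}`: the 2-division field is unramified at 2 with Frobenius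
of order 2 on the discriminant character).  No hypothesis on the conductor away from `2`.
[cite: Serre1972, §1.11]
[cite: SilvermanAEC2009, V.4 and Exercise 5.7] -/
theorem minimalDiscriminantInt_emod_eight_eq_five_of_two_dvd_frobeniusTrace_two [W.IsElliptic]
    (hgood : W.HasGoodReductionAtPrime 2) (heven : (2 : ℤ) ∣ W.frobeniusTrace 2) :
    minimalDiscriminantInt W % 8 = 5 := by
  have h1 : Even (integralModelInt W).a₁ :=
    even_iff_two_dvd.mpr (two_dvd_a₁_integralModelInt_of_two_dvd_frobeniusTrace_two W hgood heven)
  have hΔodd : Odd (integralModelInt W).Δ := by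
    rw [← Int.not_even_iff_odd, even_iff_two_dvd]
    exact_mod_cast not_dvd_minimalDiscriminantInt_of_hasGoodReductionAtPrime' W 2 hgood
  exact Δ_emod_eight_eq_five_of_even_a₁_of_odd_Δ (integralModelInt W) h1 hΔodd

/-- The same with the discriminant of the given (globally minimal) equation: if `W.Δ = D` for an integer `D`, then `D % 8 = 5`.
[cite: Serre1972, §1.11] -/
theorem intCast_Δ_emod_eight_eq_five_of_two_dvd_frobeniusTrace_two [W.IsElliptic]
    (hgood : W.HasGoodReductionAtPrime 2) (heven : (2 : ℤ) ∣ W.frobeniusTrace 2) {D : ℤ} (hD : W.Δ = (D : ℚ)) :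
    D % 8 = 5 := by
  have h := minimalDiscriminantInt_emod_eight_eq_five_of_two_dvd_frobeniusTrace_two W hgood heven
  have hcast : (minimalDiscriminantInt W : ℚ) = (D : ℚ) := by rw [cast_minimalDiscriminantInt, hD]
  rwa [Int.cast_inj.mp hcast] at h

end Literature.NumberTheory.EllipticCurves

end
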